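import Summits.Schanuel.Schanuel.Theorems.ZilberEacComplexMovingPolydisc
import Mathlib.Algebra.MvPolynomial.Funext
import HarnessLib

/-!
# THEOREM J (directional dominance) — lemmas: directional components, growth of homogeneous forms,
# Zariski density of lattice directions

Zilber's Exponential-Algebraic Closedness, case ladder (host summit Schanuel, cell `pub-schanuel`,
seat 2, gen 9).  Technical lemmas for `ZilberEacDirectionalDominance`:

* Part A — `eval_cons_eq_sum`: for `H ∈ ℂ[W, X₁..X_t]` (variable `0` = `W`) and
  `P = finSuccEquiv H ∈ ℂ[X][W]`, `H(w, x) = Σ_{N, c} G_{c,N}(x) w^c` with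
  `G_{c,N} = homogeneousComponent N (P.coeff c)` the DIRECTIONAL COMPONENTS of `H`;
* Part B — `eventually_norm_eval_homogeneous_bounds` / `eventually_log_norm_eval_homogeneous`: for
  `G` homogeneous of degree `N` with `G(v) ≠ 0` and `x_m = m v + o(m)`:
  `(‖G(v)‖/4) m^N ≤ ‖G(x_m)‖ ≤ 3‖G(v)‖ m^N`, i.e. `log ‖G(x_m)‖ = N log m + O(1)`
  (from the cell's `latticeValue_control`); `eventually_le_mul_of_le_log` (`O(log m) = o(m)`);
* Part D — `exists_int_eval_ne_zero`, `latticeDirections_dense`: the lattice directions `a q`,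
  `q ∈ ℤ^t` (`a ≠ 0`), off any hypersurface, support no nonzero polynomial
  (`MvPolynomial.funext_set` on the box `ℤ^t`, and the scaling automorphism `Xᵢ ↦ a Xᵢ`).

HONEST FRAMING: elementary lemmas; `EC(3,2)` OPEN; nothing here bears on Schanuel's conjecture
(EAC ⇏ SC).
-/

noncomputable section

open MvPolynomial Filter Topology Finset

set_option linter.dupNamespace false

namespace Summit.Schanuel.Schanuel.Theorems

/-! ## Part A. Evaluation of `H ∈ ℂ[W, X]` as a double sum over directional components -/

section Decomposition

variable {t : ℕ}

/-- Summing the homogeneous components up to any bound `> totalDegree` gives the polynomial back.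
[folklore] -/
theorem sum_homogeneousComponent_of_lt (φ : MvPolynomial (Fin t) ℂ) {M : ℕ}
    (hM : φ.totalDegree < M) : ∑ N ∈ range M, homogeneousComponent N φ = φ := by
  conv_rhs => rw [← sum_homogeneousComponent φ]
  refine (Finset.sum_subset (Finset.range_subset_range.2 (Nat.succ_le_of_lt hM)) ?_).symm
  intro N hN hN'
  rw [Finset.mem_range, Nat.lt_succ_iff, not_le] at hN'
  exact homogeneousComponent_eq_zero _ _ hN'

/-- **Double-sum expansion.**  With `P = finSuccEquiv H ∈ ℂ[X₁..X_t][W]`, `D > deg_W P` and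
`Nmax > deg G` for every `W`-coefficient `G`:
`H(w, x) = Σ_{N < Nmax, c < D} (homogeneousComponent N (P.coeff c))(x) · w^c`. [folklore] -/
theorem eval_cons_eq_sum (H : MvPolynomial (Fin (t + 1)) ℂ) {D Nmax : ℕ}
    (hD : (finSuccEquiv ℂ t H).natDegree < D)
    (hN : ∀ c, ((finSuccEquiv ℂ t H).coeff c).totalDegree < Nmax) (w : ℂ) (x : Fin t → ℂ) :
    eval (Fin.cons w x : Fin (t + 1) → ℂ) H = ∑ p ∈ range Nmax ×ˢ range D,
      eval x (homogeneousComponent p.1 ((finSuccEquiv ℂ t H).coeff p.2)) * w ^ p.2 := by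
  rw [eval_eq_eval_mv_eval', Polynomial.eval_eq_sum_range'
    ((Polynomial.natDegree_map_le).trans_lt hD), Finset.sum_product_right]
  refine Finset.sum_congr rfl fun c _ => ?_
  dsimp only
  rw [Polynomial.coeff_map, ← Finset.sum_mul, ← map_sum, sum_homogeneousComponent_of_lt _ (hN c)]

/-- A nonzero directional component lies in the coefficient rectangle: `c ≤ deg_W P`. [folklore] -/
theorem le_natDegree_of_homogeneousComponent_coeff_ne_zero (H : MvPolynomial (Fin (t + 1)) ℂ)
    {c N : ℕ} (h : homogeneousComponent N ((finSuccEquiv ℂ t H).coeff c) ≠ 0) :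
    c ≤ (finSuccEquiv ℂ t H).natDegree := by
  by_contra hc
  rw [not_le] at hc
  rw [Polynomial.coeff_eq_zero_of_natDegree_lt hc, map_zero] at h
  exact h rfl

/-- … and `N ≤ deg (P.coeff c)`. [folklore] -/
theorem le_totalDegree_of_homogeneousComponent_coeff_ne_zero (H : MvPolynomial (Fin (t + 1)) ℂ)
    {c N : ℕ} (h : homogeneousComponent N ((finSuccEquiv ℂ t H).coeff c) ≠ 0) :
    N ≤ ((finSuccEquiv ℂ t H).coeff c).totalDegree := by
  by_contra hN
  rw [not_le] at hN
  exact h (homogeneousComponent_eq_zero _ _ hN)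

end Decomposition

/-! ## Part B. Growth of a homogeneous form along `x_m = m v + o(m)` -/

section Growth

variable {t : ℕ}

/-- **Two-sided growth of a homogeneous form along a sequence of direction `v`.**  `G` homogeneous
of degree `N`, `G(v) ≠ 0`, `x_m = m v + o(m)`: then `(a/4) m^N ≤ ‖G(x_m)‖ ≤ 3a m^N` for large `m`,
`a = ‖G(v)‖` (from `latticeValue_control`). [folklore] -/
theorem eventually_norm_eval_homogeneous_bounds {G : MvPolynomial (Fin t) ℂ} {N : ℕ}
    (hG : G.IsHomogeneous N) {v : Fin t → ℂ} (hv : eval v G ≠ 0) {x : ℕ → Fin t → ℂ}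
    (hx : ∀ ρ : ℝ, 0 < ρ → ∀ᶠ m : ℕ in atTop, ‖x m - fun i => (m : ℂ) * v i‖ ≤ ρ * m) :
    ∀ᶠ m : ℕ in atTop, ‖eval v G‖ / 4 * (m : ℝ) ^ N ≤ ‖eval (x m) G‖ ∧
      ‖eval (x m) G‖ ≤ 3 * ‖eval v G‖ * (m : ℝ) ^ N := by
  have hG0 : G ≠ 0 := by rintro rfl; exact hv (map_zero _)
  have htd : G.totalDegree = N := hG.totalDegree hG0
  have hself : homogeneousComponent G.totalDegree G = G := by
    rw [htd]; exact homogeneousComponent_eq_self hG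
  have hA : eval v (homogeneousComponent G.totalDegree G) ≠ 0 := by rwa [hself]
  obtain ⟨ρ, hρ, t₀, -, hc⟩ := latticeValue_control G v hA (κ := 1 / 2) (by norm_num)
  filter_upwards [hx ρ hρ, tendsto_natCast_atTop_atTop.eventually_ge_atTop t₀] with m hxm hm
  obtain ⟨-, hlow, hupp, hpert⟩ := hc m hm
  rw [hself, htd] at hlow hupp
  have hp := hpert (x m - fun i => (m : ℂ) * v i) hxm
  rw [add_sub_cancel] at hp
  set a := ‖eval v G‖
  set g0 := ‖eval (fun i => (m : ℂ) * v i) G‖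
  have h1 : ‖eval (x m) G‖ ≥ g0 - 1 / 2 * g0 := by
    have := norm_sub_norm_le (eval (fun i => (m : ℂ) * v i) G) (eval (x m) G)
    rw [← norm_neg, neg_sub] at hp
    linarith
  have h2 : ‖eval (x m) G‖ ≤ g0 + 1 / 2 * g0 := by
    have := norm_le_insert' (eval (x m) G) (eval (fun i => (m : ℂ) * v i) G)
    linarith [norm_sub_rev (eval (x m) G) (eval (fun i => (m : ℂ) * v i) G)]
  constructor <;> nlinarith

/-- **Logarithmic form**: `|log ‖G(x_m)‖ - N log m| ≤ E_G` and `G(x_m) ≠ 0` for large `m`.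
[folklore] -/
theorem eventually_log_norm_eval_homogeneous {G : MvPolynomial (Fin t) ℂ} {N : ℕ}
    (hG : G.IsHomogeneous N) {v : Fin t → ℂ} (hv : eval v G ≠ 0) {x : ℕ → Fin t → ℂ}
    (hx : ∀ ρ : ℝ, 0 < ρ → ∀ᶠ m : ℕ in atTop, ‖x m - fun i => (m : ℂ) * v i‖ ≤ ρ * m) :
    ∃ E : ℝ, ∀ᶠ m : ℕ in atTop, eval (x m) G ≠ 0 ∧
      |Real.log ‖eval (x m) G‖ - N * Real.log m| ≤ E := by
  set a := ‖eval v G‖ with ha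
  have ha0 : 0 < a := norm_pos_iff.2 hv
  refine ⟨|Real.log (a / 4)| + |Real.log (3 * a)|, ?_⟩
  filter_upwards [eventually_norm_eval_homogeneous_bounds hG hv hx,
    tendsto_natCast_atTop_atTop.eventually_ge_atTop (1 : ℝ)] with m hm hm1
  obtain ⟨hlow, hupp⟩ := hm
  have hmpos : 0 < (m : ℝ) ^ N := pow_pos (by linarith) N
  have hlowpos : 0 < a / 4 * (m : ℝ) ^ N := by positivity
  have hne : eval (x m) G ≠ 0 := norm_pos_iff.1 (hlowpos.trans_le hlow)
  refine ⟨hne, ?_⟩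
  have hgpos : 0 < ‖eval (x m) G‖ := norm_pos_iff.2 hne
  have hl1 : Real.log (a / 4) + N * Real.log m ≤ Real.log ‖eval (x m) G‖ := by
    rw [← Real.log_pow, ← Real.log_mul (by positivity) hmpos.ne']
    exact Real.log_le_log hlowpos hlow
  have hl2 : Real.log ‖eval (x m) G‖ ≤ Real.log (3 * a) + N * Real.log m := by
    rw [← Real.log_pow, ← Real.log_mul (by positivity) hmpos.ne']
    exact Real.log_le_log hgpos hupp
  rw [abs_le]
  constructor
  · linarith [neg_abs_le (Real.log (a / 4)), abs_nonneg (Real.log (3 * a))]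
  · linarith [le_abs_self (Real.log (3 * a)), abs_nonneg (Real.log (a / 4))]

/-- `O(log m)` deviations are `o(m)`: the hypothesis format of the density theorems. [folklore] -/
theorem eventually_le_mul_of_le_log {x : ℕ → Fin t → ℂ} {v : Fin t → ℂ} {C : ℝ}
    (hx : ∀ᶠ m : ℕ in atTop, ‖x m - fun i => (m : ℂ) * v i‖ ≤ C * Real.log m) (ρ : ℝ)
    (hρ : 0 < ρ) : ∀ᶠ m : ℕ in atTop, ‖x m - fun i => (m : ℂ) * v i‖ ≤ ρ * m := by
  have hlim : Tendsto (fun m : ℕ => C * Real.log m / m) atTop (𝓝 0) := by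
    have h := ((Real.isLittleO_log_id_atTop).tendsto_div_nhds_zero.comp
      tendsto_natCast_atTop_atTop).const_mul C
    rw [mul_zero] at h
    refine h.congr fun m => ?_
    simp only [Function.comp_apply, id_eq]
    ring
  filter_upwards [hx, hlim.eventually (gt_mem_nhds hρ),
    tendsto_natCast_atTop_atTop.eventually_gt_atTop (0 : ℝ)] with m hm hlt hm0
  have : C * Real.log m ≤ ρ * m := by
    rw [div_lt_iff₀ hm0] at hlt
    exact hlt.le
  exact hm.trans this

end Growth

/-! ## Part D. Lattice directions are Zariski dense -/

section Lattice

variable {t : ℕ}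

/-- Scaling the variables by a nonzero constant is injective on `ℂ[X₁..X_t]`. [folklore] -/
theorem bind₁_scale_ne_zero {G : MvPolynomial (Fin t) ℂ} (hG : G ≠ 0) {a : ℂ} (ha : a ≠ 0) :
    bind₁ (fun i => C a * X i) G ≠ 0 := by
  intro h
  apply hG
  have hcomp : bind₁ (fun i => C a⁻¹ * X i) (bind₁ (fun i => C a * X i) G) = G := by
    rw [bind₁_bind₁]
    have : (fun i => bind₁ (fun i => C a⁻¹ * X i) (C a * X i : MvPolynomial (Fin t) ℂ)) = X := by
      funext i
      rw [map_mul, bind₁_C_right, bind₁_X_right, ← mul_assoc, ← map_mul, mul_inv_cancel₀ ha,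
        map_one, one_mul]
    rw [this, bind₁_X_left, AlgHom.id_apply]
  rw [← hcomp, h, map_zero]

/-- **Lattice directions are Zariski dense**: for `G ≠ 0` and `a ≠ 0` some `q ∈ ℤ^t` has
`G(a q) ≠ 0` (a polynomial vanishing on the box `ℤ^t` is zero). [folklore] -/
theorem exists_int_eval_ne_zero {G : MvPolynomial (Fin t) ℂ} (hG : G ≠ 0) {a : ℂ} (ha : a ≠ 0) :
    ∃ q : Fin t → ℤ, eval (fun i => a * (q i : ℂ)) G ≠ 0 := by
  by_contra hcon
  push Not at hcon
  apply bind₁_scale_ne_zero hG ha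
  refine MvPolynomial.funext_set (fun _ : Fin t => Set.range ((↑) : ℤ → ℂ))
    (fun _ => Set.infinite_range_of_injective Int.cast_injective) fun y hy => ?_
  rw [map_zero]
  have hy' : ∀ i, ∃ q : ℤ, (q : ℂ) = y i := fun i => hy i (Set.mem_univ i)
  choose q hq using hy'
  have hyq : y = fun i => (q i : ℂ) := funext fun i => (hq i).symm
  rw [hyq]
  change eval₂Hom (RingHom.id ℂ) (fun i => (q i : ℂ)) (bind₁ (fun i => C a * X i) G) = 0
  rw [eval₂Hom_bind₁]
  have : (fun i => eval₂Hom (RingHom.id ℂ) (fun i => (q i : ℂ)) (C a * X i : MvPolynomial (Fin t) ℂ)) =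
      fun i => a * (q i : ℂ) := by
    funext i; simp
  rw [this]
  exact hcon q

/-- The set of lattice directions `a q` (`q ∈ ℤ^t`) off a hypersurface `L = 0` (`L ≠ 0`) supports
no nonzero polynomial: the density hypothesis of THEOREM J. [folklore] -/
theorem latticeDirections_dense {L : MvPolynomial (Fin t) ℂ} (hL : L ≠ 0) {a : ℂ} (ha : a ≠ 0)
    (G : MvPolynomial (Fin t) ℂ) (hG : G ≠ 0) :
    ∃ v ∈ {v : Fin t → ℂ | (∃ q : Fin t → ℤ, v = fun i => a * (q i : ℂ)) ∧ eval v L ≠ 0},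
      eval v G ≠ 0 := by
  obtain ⟨q, hq⟩ := exists_int_eval_ne_zero (mul_ne_zero hL hG) ha
  rw [map_mul] at hq
  exact ⟨fun i => a * (q i : ℂ), ⟨⟨q, rfl⟩, left_ne_zero_of_mul hq⟩, right_ne_zero_of_mul hq⟩

end Lattice

end Summit.Schanuel.Schanuel.Theorems

end
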